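import Summits.CriticalPhenomena.Ising3DConformalLimit.Theorems.PrecisionLaplacianMoebiusLimitOfTwoPointLawTwoShellGlue
import Summits.CriticalPhenomena.Ising3DConformalLimit.Theorems.PrecisionLaplacianMoebiusLimitOfTwoPointLawDensityOfLawReversal
import HarnessLib

/-!
# Crux `MoebiusLimitOfTwoPointLaw` (item stmt-CriticalPhenomena-4801): assembly from EXISTENCE and LAW-LEVEL
# sphere-inversion reversibility (line `two-shell-exchange-markov`, lead, final shape)

The lead's kernel-checked findings on this crux assemble as follows.

* `moebiusLimitOfTwoPointLaw_iff_existence_and_inversion` (`…ExistenceAndInversion.lean`): the crux ⇔ for every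
  witness `(Δ, c)` of the two-point law, (a) existence of the even canonical limits + (c) their unit-inversion
  covariance; `O(3)`, translations, dilations and the arities `≤ 3` are free.
* (a) is item stmt-CriticalPhenomena-5355 `PrimaryAtInfinity.ExistsRegularLimit` (shared by every line).
* (c) in the form an ENGINE produces it — a statement about the LAW of the limit field, tested on smooth functions
  compactly supported off the origin with pairwise disjoint supports — is the Prop spelled out as the second
  hypothesis below ("law-level `ι_λ`-reversibility of every regular limit under the two-point law"); the landed
  density lemma `stub_densityOfLawReversal` (K2b, `…DensityOfLawReversal.lean`) turns it into pointwise
  `ι_λ`-covariance, and the landed glue `stub_moebiusOfReversibleLimits` (`…TwoShellGlue.lean`; dilations free,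
  `ι₁ ∈ {ι_λ}`, `O(3)` from translations + `ι₁` by the landed group lemma) into the crux.

`moebiusLimitOfTwoPointLaw_of_existsRegularLimit_of_lawReversal` is that assembly: **4801 ⇐ 5355 ∧ [law-level
`ι_λ`-reversibility of regular limits]** — the recommended split of the crux into its two irreducible halves (the
lead's `promote-stub` verdict names the second half, registered as stub `stub_lawReversal` of the line skeleton with
the line's Markov inputs as extra hypotheses).
References: Di Francesco–Mathieu–Sénéchal 1997 §4.2.1 (4.32), §4.3.1 (4.48) [FrancescoMathieuSenechal1997]; Kelly 1979
ch. 1 (reversibility) [Kelly1979].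
-/

noncomputable section

namespace Summit.CriticalPhenomena.Ising3DConformalLimit.PrecisionLaplacianMoebiusLimitOfTwoPointLaw

open Literature.Probability.LatticeModels Filter Topology MeasureTheory
open Summit.CriticalPhenomena.Ising3DConformalLimit.Theorems.MoebiusLimitOfTwoPointLaw.Negative
  (sphereInversionCovariant)

/-- **4801 ⇐ 5355 ∧ law-level `ι_λ`-reversibility.** If a regular translation-invariant pointwise limit of
`criticalCorr 3` exists (item 5355, by name) and, under the two-point law, the law of every regular limit is
invariant under the Weyl-weighted origin-centred sphere inversions — the smeared identity
`∫ S_n(x) ∏ᵢ (λ/‖xᵢ‖²)^{3−Δ} fᵢ(ι_λ xᵢ) dx = ∫ S_n(x) ∏ᵢ fᵢ(xᵢ) dx` for smooth `fᵢ` compactly supported off the origin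
with pairwise disjoint supports — then `MoebiusLimitOfTwoPointLaw` holds. Composition of the landed
`stub_densityOfLawReversal` (smeared ⇒ pointwise) and `stub_moebiusOfReversibleLimits` (pointwise ⇒ Möbius ⇒ crux). -/
theorem moebiusLimitOfTwoPointLaw_of_existsRegularLimit_of_lawReversal :
    Theses.PrimaryAtInfinity.ExistsRegularLimit →
    (∀ (Δ c : ℝ), 0 < c →
      Tendsto (fun x : Site 3 =>
        criticalTwoPoint 3 x * Real.sqrt (∑ i, ((x i : ℝ)) ^ 2) ^ (2 * Δ)) cofinite (nhds c) →
      ∀ (ρ : ℝ → ℝ) (S : CorrFamily 3), (∀ δ ∈ Set.Ioc (0 : ℝ) 1, 0 < ρ δ) →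
        HasPointwiseScalingLimit (criticalCorr 3) ρ S →
        (∀ n z, z ∉ NonCoincident 3 n → S n z = 0) →
        IsTranslationInvariant S → (∀ n, ContinuousOn (S n) (NonCoincident 3 n)) →
        IsScaleCovariant Δ S →
        (∃ c' : ℝ, 0 < c' ∧ ∀ a b : EuclideanSpace ℝ (Fin 3), a ≠ b → S 2 ![a, b] = c' * ‖a - b‖ ^ (-(2 * Δ))) →
        ∀ (n : ℕ) (lam : ℝ), 0 < lam → ∀ (f : Fin n → EuclideanSpace ℝ (Fin 3) → ℝ),
          (∀ i, ContDiff ℝ ((⊤ : ℕ∞) : WithTop ℕ∞) (f i) ∧ HasCompactSupport (f i) ∧ tsupport (f i) ⊆ {0}ᶜ) →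
          (∀ i j, i ≠ j → Disjoint (tsupport (f i)) (tsupport (f j))) →
          (∫ x : Fin n → EuclideanSpace ℝ (Fin 3),
              S n x * ∏ i, ((lam / ‖x i‖ ^ 2) ^ ((3 : ℝ) - Δ) * f i ((lam / ‖x i‖ ^ 2) • x i))) =
            ∫ x : Fin n → EuclideanSpace ℝ (Fin 3), S n x * ∏ i, f i (x i)) →
    Theses.PrecisionLaplacian.MoebiusLimitOfTwoPointLaw :=
  fun hE hLaw => stub_moebiusOfReversibleLimits hE
    fun Δ c hc hP ρ S hρ hlim hnorm htr hcont hsc h2pt =>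
      stub_densityOfLawReversal Δ S hcont hnorm (hLaw Δ c hc hP ρ S hρ hlim hnorm htr hcont hsc h2pt)

/-- The same assembly under the second host route's spelling of the crux (`Theses.BernsteinTemperature`). -/
theorem moebiusLimitOfTwoPointLaw_of_existsRegularLimit_of_lawReversal' :
    Theses.PrimaryAtInfinity.ExistsRegularLimit →
    (∀ (Δ c : ℝ), 0 < c →
      Tendsto (fun x : Site 3 =>
        criticalTwoPoint 3 x * Real.sqrt (∑ i, ((x i : ℝ)) ^ 2) ^ (2 * Δ)) cofinite (nhds c) →
      ∀ (ρ : ℝ → ℝ) (S : CorrFamily 3), (∀ δ ∈ Set.Ioc (0 : ℝ) 1, 0 < ρ δ) →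
        HasPointwiseScalingLimit (criticalCorr 3) ρ S →
        (∀ n z, z ∉ NonCoincident 3 n → S n z = 0) →
        IsTranslationInvariant S → (∀ n, ContinuousOn (S n) (NonCoincident 3 n)) →
        IsScaleCovariant Δ S →
        (∃ c' : ℝ, 0 < c' ∧ ∀ a b : EuclideanSpace ℝ (Fin 3), a ≠ b → S 2 ![a, b] = c' * ‖a - b‖ ^ (-(2 * Δ))) →
        ∀ (n : ℕ) (lam : ℝ), 0 < lam → ∀ (f : Fin n → EuclideanSpace ℝ (Fin 3) → ℝ),
          (∀ i, ContDiff ℝ ((⊤ : ℕ∞) : WithTop ℕ∞) (f i) ∧ HasCompactSupport (f i) ∧ tsupport (f i) ⊆ {0}ᶜ) →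
          (∀ i j, i ≠ j → Disjoint (tsupport (f i)) (tsupport (f j))) →
          (∫ x : Fin n → EuclideanSpace ℝ (Fin 3),
              S n x * ∏ i, ((lam / ‖x i‖ ^ 2) ^ ((3 : ℝ) - Δ) * f i ((lam / ‖x i‖ ^ 2) • x i))) =
            ∫ x : Fin n → EuclideanSpace ℝ (Fin 3), S n x * ∏ i, f i (x i)) →
    Theses.BernsteinTemperature.MoebiusLimitOfTwoPointLaw :=
  moebiusLimitOfTwoPointLaw_of_existsRegularLimit_of_lawReversal

end Summit.CriticalPhenomena.Ising3DConformalLimit.PrecisionLaplacianMoebiusLimitOfTwoPointLaw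

end
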